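import Mathlib.Analysis.Calculus.ContDiff.Basic
import Mathlib.Analysis.Calculus.MeanValue
import Mathlib.Analysis.Normed.Module.FiniteDimension
import Mathlib.Topology.MetricSpace.HausdorffDistance
import HarnessLib

/-!
# Gluing a jet on a closed set to a smooth function off it

Support file 5/7 for the planned proof of `Literature.Analysis.Calculus.WhitneyExtensionConvex`
(`WhitneyExtension.lean`; Whitney (1934), Thm. I, on closed convex sets with nonempty
interior): the step "`g` is of class `Cᴺ` in `E`" of Whitney's proof (Whitney (1934), §11,
via his Lemma 1; Hörmander, *ALPDO I*, proof of Thm. 2.3.6, via Cor. 1.1.2), in the following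
form.  Let `K` be a closed subset, with unique derivatives, of a proper (e.g.
finite-dimensional) real normed space, `f` of class `Cᴺ` on `K` in the within sense, and `g`
a function equal to `f` on `K` and of class `Cᴺ` on the open set `Kᶜ`.  If at every point `x`
of `K` the derivatives of `g` of orders `m ≤ N` tend, from `Kᶜ`, to the within-derivatives of
`f` at `x`, then `g` is of class `Cᴺ` on the whole space and its derivatives on `K` are the
within-derivatives of `f` (`Literature.Analysis.Calculus.WhitneyConvex.contDiff_of_tendsto_iteratedFDeriv`,
`iteratedFDeriv_eq_of_tendsto_iteratedFDeriv`; all orders: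
`contDiff_infty_of_tendsto_iteratedFDeriv`).

The glued formal Taylor series (`f`'s within `K` on `K`, `g`'s off `K`) is a Taylor series on
the whole space (`hasFTaylorSeriesUpToOn_glued`).  The only delicate point is the derivative
at a point `x ∈ K` *from outside*: for `y ∉ K` near `x` take a nearest point `b ∈ K` of `y`
(proper space); the half-open segment `[y, b)` lies in `Kᶜ`, so the mean value inequality
along it (Mathlib's `norm_image_sub_le_of_norm_deriv_le_segment'`), the limit hypothesis at
`b` (to reach the endpoint) and at `x` (to control the derivative along the segment, all of
whose points are within `2‖y - x‖` of `x`), and the differentiability of the jet within `K`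
at `x` applied at `b` (`‖b - x‖ ≤ 2 ‖y - x‖`) give the little-`o` estimate.  This generalizes
the tree's `Literature.Analysis.Calculus.Seeley.contDiffOn_of_tendsto_iteratedFDerivWithin`
(`SeeleyExtension.lean`, the case of a half-space, via Mathlib's
`hasFDerivWithinAt_closure_of_tendsto_fderiv`, which needs a convex outer region).

## References

* H. Whitney, *Analytic extensions of differentiable functions defined in closed sets*, Trans.
  Amer. Math. Soc. 36 (1934), 63–89, §5 Lemma 1 and §11. [Whitney1934]
* L. Hörmander, *The Analysis of Linear Partial Differential Operators I*, Thm. 2.3.6 (proof)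
  and Cor. 1.1.2. [HormanderALPDO1]
-/

open Set Metric Filter Function
open scoped ContDiff Topology

noncomputable section

namespace Literature.Analysis.Calculus.WhitneyConvex

variable {E : Type*} [NormedAddCommGroup E] [NormedSpace ℝ E]
variable {F : Type*} [NormedAddCommGroup F] [NormedSpace ℝ F]

/-! ### Segments to a nearest point -/

/-- If `b ∈ K` is a nearest point of `y` in the closed set `K`, the points `y + s (b - y)`,
`0 ≤ s < 1`, of the half-open segment lie off `K`. [folklore] -/
theorem lineMap_nearest_notMem {K : Set E} (hK : IsClosed K) {y b : E} (hy : y ∉ K) (hb : b ∈ K)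
    (hnear : infDist y K = dist y b) {s : ℝ} (hs0 : 0 ≤ s) (hs1 : s < 1) :
    y + s • (b - y) ∉ K := by
  intro hz
  have hne : K.Nonempty := ⟨b, hb⟩
  have hpos : 0 < infDist y K := (hK.notMem_iff_infDist_pos hne).1 hy
  have h1 : infDist y K ≤ dist y (y + s • (b - y)) := infDist_le_dist_of_mem hz
  rw [hnear, dist_eq_norm, dist_eq_norm, show y - (y + s • (b - y)) = s • (y - b) by
    rw [sub_add_cancel_left, ← smul_neg, neg_sub], norm_smul, Real.norm_of_nonneg hs0] at h1
  have h2 : 0 < ‖y - b‖ := by rwa [hnear, dist_eq_norm] at hpos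
  nlinarith

/-- Points of the segment from `y` to a nearest point `b` are within `‖y - x‖ + ‖y - b‖` hence
within `2 ‖y - x‖` of any `x ∈ K`. [folklore] -/
theorem norm_lineMap_sub_le {K : Set E} {y b x : E} (hx : x ∈ K) (hnear : infDist y K = dist y b)
    {s : ℝ} (hs0 : 0 ≤ s) (hs1 : s ≤ 1) : ‖y + s • (b - y) - x‖ ≤ 2 * ‖y - x‖ := by
  have hyb : ‖y - b‖ ≤ ‖y - x‖ := by
    rw [← dist_eq_norm, ← dist_eq_norm, ← hnear]
    exact infDist_le_dist_of_mem hx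
  calc ‖y + s • (b - y) - x‖ = ‖(y - x) + s • (b - y)‖ := by congr 1; abel
    _ ≤ ‖y - x‖ + ‖s • (b - y)‖ := norm_add_le _ _
    _ = ‖y - x‖ + s * ‖y - b‖ := by rw [norm_smul, Real.norm_of_nonneg hs0, norm_sub_rev b y]
    _ ≤ ‖y - x‖ + 1 * ‖y - x‖ := by gcongr
    _ = 2 * ‖y - x‖ := by ring

/-- A nearest point is within `2 ‖y - x‖` of any `x ∈ K`. [folklore] -/
theorem norm_nearest_sub_le {K : Set E} {y b x : E} (hx : x ∈ K) (hnear : infDist y K = dist y b) :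
    ‖b - x‖ ≤ 2 * ‖y - x‖ := by
  have := norm_lineMap_sub_le hx hnear zero_le_one le_rfl
  simpa using this

/-! ### The glued Taylor series -/

section Glue

variable {K : Set E} {f g : E → F}

open scoped Classical in
/-- The glued formal Taylor series: `f`'s series within `K` on `K`, `g`'s series off `K`.
[folklore] -/
def gluedSeries (K : Set E) (f g : E → F) (x : E) : FormalMultilinearSeries ℝ E F :=
  if x ∈ K then ftaylorSeriesWithin ℝ f K x else ftaylorSeries ℝ g x

/-- On `K` the glued series is `f`'s. [folklore] -/
theorem gluedSeries_of_mem {x : E} (hx : x ∈ K) : gluedSeries K f g x = ftaylorSeriesWithin ℝ f K x := by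
  unfold gluedSeries; rw [if_pos hx]

/-- Off `K` the glued series is `g`'s. [folklore] -/
theorem gluedSeries_of_notMem {x : E} (hx : x ∉ K) : gluedSeries K f g x = ftaylorSeries ℝ g x := by
  unfold gluedSeries; rw [if_neg hx]

/-- **The mean value step.**  Let `y ∉ K` with nearest point `b ∈ K`, `G : E → F'` a map with
`HasFDerivAt G (G' z) z` and `‖G' z - L‖ ≤ ε` at every point `z` of the half-open segment
`[y, b)`, and suppose `G z → Gb` as `z → b` within `Kᶜ`.  Then
`‖(Gb - L b) - (G y - L y)‖ ≤ ε ‖b - y‖`. [folklore] -/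
theorem norm_sub_sub_le_of_segment {F' : Type*} [NormedAddCommGroup F'] [NormedSpace ℝ F']
    (hK : IsClosed K) {y b : E} (hy : y ∉ K) (hb : b ∈ K) (hnear : infDist y K = dist y b)
    {G : E → F'} {G' : E → E →L[ℝ] F'} {L : E →L[ℝ] F'} {ε : ℝ}
    (hder : ∀ s ∈ Ico (0 : ℝ) 1, HasFDerivAt G (G' (y + s • (b - y))) (y + s • (b - y)))
    (hbound : ∀ s ∈ Ico (0 : ℝ) 1, ‖G' (y + s • (b - y)) - L‖ ≤ ε)
    {Gb : F'} (hlim : Tendsto G (𝓝[Kᶜ] b) (𝓝 Gb)) :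
    ‖(Gb - L b) - (G y - L y)‖ ≤ ε * ‖b - y‖ := by
  set v : E := b - y with hv
  set γ : ℝ → E := fun s => y + s • v with hγ
  set φ : ℝ → F' := fun s => G (γ s) - L (γ s) with hφ
  have hγd : ∀ s, HasDerivAt γ v s := fun s => by
    have := ((hasDerivAt_id s).smul_const v).const_add y
    simpa [hγ] using this
  -- derivative of `φ` on `[0, 1)`
  have hφd : ∀ s ∈ Ico (0 : ℝ) 1, HasDerivAt φ ((G' (γ s) - L) v) s := by
    intro s hs
    have h1 : HasDerivAt (fun s => G (γ s)) (G' (γ s) v) s :=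
      (hder s hs).comp_hasDerivAt s (hγd s)
    have h2 : HasDerivAt (fun s => L (γ s)) (L v) s := L.hasFDerivAt.comp_hasDerivAt s (hγd s)
    have h3 := h1.sub h2
    rw [← ContinuousLinearMap.sub_apply'] at h3
    exact h3
  -- mean value inequality on `[0, s₀]`, `s₀ < 1`
  have hmv : ∀ s₀ ∈ Ico (0 : ℝ) 1, ‖φ s₀ - φ 0‖ ≤ ε * ‖v‖ * s₀ := by
    intro s₀ hs₀
    have h := norm_image_sub_le_of_norm_deriv_le_segment' (f := φ)
      (f' := fun s => (G' (γ s) - L) v) (a := 0) (b := s₀)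
      (fun s hs => (hφd s ⟨hs.1, lt_of_le_of_lt hs.2 hs₀.2⟩).hasDerivWithinAt)
      (fun s hs => by
        calc ‖(G' (γ s) - L) v‖ ≤ ‖G' (γ s) - L‖ * ‖v‖ := ContinuousLinearMap.le_opNorm _ _
          _ ≤ ε * ‖v‖ := mul_le_mul_of_nonneg_right (hbound s ⟨hs.1, hs.2.trans hs₀.2⟩)
              (norm_nonneg _)) s₀ (right_mem_Icc.2 hs₀.1)
    simpa using h
  -- pass to the limit `s₀ → 1⁻`
  have hγ1 : Tendsto γ (𝓝[<] 1) (𝓝[Kᶜ] b) := by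
    refine tendsto_nhdsWithin_iff.2 ⟨?_, ?_⟩
    · have : Continuous γ := continuous_const.add (continuous_id.smul continuous_const)
      have h1 : γ 1 = b := by simp [hγ, hv]
      rw [← h1]
      exact this.continuousAt.tendsto.mono_left nhdsWithin_le_nhds
    · filter_upwards [Ioo_mem_nhdsLT (show (0 : ℝ) < 1 by norm_num)] with s hs
      exact lineMap_nearest_notMem hK hy hb hnear hs.1.le hs.2
  have hφlim : Tendsto φ (𝓝[<] 1) (𝓝 (Gb - L b)) := by
    have h1 : Tendsto (fun s => G (γ s)) (𝓝[<] 1) (𝓝 Gb) := hlim.comp hγ1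
    have h2 : Tendsto (fun s => L (γ s)) (𝓝[<] 1) (𝓝 (L b)) :=
      (L.continuous.tendsto b).comp (tendsto_nhds_of_tendsto_nhdsWithin hγ1)
    exact h1.sub h2
  have hlhs : Tendsto (fun s₀ => ‖φ s₀ - φ 0‖) (𝓝[<] 1) (𝓝 ‖(Gb - L b) - (G y - L y)‖) := by
    have h0 : φ 0 = G y - L y := by simp [hφ, hγ]
    rw [← h0]
    exact (hφlim.sub tendsto_const_nhds).norm
  have hrhs : Tendsto (fun s₀ : ℝ => ε * ‖v‖ * s₀) (𝓝[<] 1) (𝓝 (ε * ‖v‖)) := by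
    have : Tendsto (fun s₀ : ℝ => ε * ‖v‖ * s₀) (𝓝 1) (𝓝 (ε * ‖v‖ * 1)) :=
      (continuous_const.mul continuous_id).tendsto 1
    rw [mul_one] at this
    exact this.mono_left nhdsWithin_le_nhds
  exact le_of_tendsto_of_tendsto hlhs hrhs (by
    filter_upwards [Ioo_mem_nhdsLT (show (0 : ℝ) < 1 by norm_num)] with s hs
    exact hmv s ⟨hs.1.le, hs.2⟩)

variable [ProperSpace E]

/-- **Gluing a jet to a smooth function off a closed set.**  `K` closed with unique
derivatives in a proper real normed space, `f` of class `Cᴺ` on `K` (within), `g = f` on `K`,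
`g` of class `Cᴺ` on `Kᶜ`, and at every point of `K` the derivatives of `g` of orders `≤ N` tend
from `Kᶜ` to the within-derivatives of `f`: then the glued series is a Taylor series of `g` of
order `N` on the whole space. [cite: Whitney1934, §11 with §5 Lemma 1] -/
theorem hasFTaylorSeriesUpToOn_glued (hK : IsClosed K) (hKu : UniqueDiffOn ℝ K) {N : ℕ}
    (hf : ContDiffOn ℝ N f K) (hg : ContDiffOn ℝ N g Kᶜ) (hfg : EqOn g f K)
    (hlim : ∀ m : ℕ, m ≤ N → ∀ x ∈ K, Tendsto (iteratedFDeriv ℝ m g) (𝓝[Kᶜ] x)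
      (𝓝 (iteratedFDerivWithin ℝ m f K x))) :
    HasFTaylorSeriesUpToOn N g (gluedSeries K f g) univ := by
  have hKo : IsOpen Kᶜ := hK.isOpen_compl
  set PK := ftaylorSeriesWithin ℝ f K with hPK
  set PG := ftaylorSeries ℝ g with hPG
  have hSK : HasFTaylorSeriesUpToOn N f PK K := hf.ftaylorSeriesWithin hKu
  have hSG : HasFTaylorSeriesUpToOn N g PG Kᶜ :=
    (hg.ftaylorSeriesWithin hKo.uniqueDiffOn).congr_series fun k _ y hy => by
      show iteratedFDerivWithin ℝ k g Kᶜ y = iteratedFDeriv ℝ k g y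
      exact iteratedFDerivWithin_of_isOpen k hKo hy
  set P := gluedSeries K f g with hP
  have hPK' : ∀ x ∈ K, P x = PK x := fun x hx => gluedSeries_of_mem hx
  have hPG' : ∀ x, x ∉ K → P x = PG x := fun x hx => gluedSeries_of_notMem hx
  have hlt : ∀ {m : ℕ}, (m : ℕ∞ω) < N → m < N := fun h => by exact_mod_cast h
  refine ⟨fun x _ => ?_, fun m hm x _ => ?_, fun m hm => ?_⟩
  · -- zero_eq
    by_cases hx : x ∈ K
    · rw [hPK' x hx, hfg hx]; exact hSK.zero_eq x hx
    · rw [hPG' x hx]; exact hSG.zero_eq x hx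
  · -- fderivWithin
    by_cases hx : x ∈ K
    · -- point of `K`: union of the two sides
      rw [hPK' x hx, ← union_compl_self K]
      refine HasFDerivWithinAt.union ?_ ?_
      · exact (hSK.fderivWithin m hm x hx).congr (fun y hy => by rw [hPK' y hy]) (by rw [hPK' x hx])
      · -- from outside: the segment argument
        set L : E →L[ℝ] (E [×m]→L[ℝ] F) := (PK x (m + 1)).curryLeft with hL
        rw [hasFDerivWithinAt_iff_isLittleO, Asymptotics.isLittleO_iff]
        intro c hc
        set ε : ℝ := c / 3 with hε
        have hε0 : 0 < ε := by positivity
        -- (a) derivatives of order `m + 1` of `g` near `x`, from outside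
        obtain ⟨δ₁, hδ₁, h₁⟩ := Metric.tendsto_nhdsWithin_nhds.1 (hlim (m + 1) (hlt hm) x hx) ε hε0
        -- (b) differentiability of the jet within `K` at `x`
        have h₂' := (hSK.fderivWithin m hm x hx).isLittleO
        rw [Asymptotics.isLittleO_iff] at h₂'
        obtain ⟨δ₂, hδ₂, h₂⟩ := Metric.mem_nhdsWithin_iff.1 (h₂' hε0)
        refine Metric.mem_nhdsWithin_iff.2 ⟨min δ₁ δ₂ / 2, by positivity, fun y hy => ?_⟩
        obtain ⟨hy, hyK⟩ := hy
        have hyK : y ∉ K := hyK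
        rw [mem_ball, dist_eq_norm] at hy
        show ‖P y m - P x m - L (y - x)‖ ≤ c * ‖y - x‖
        rw [show P x m = PK x m by rw [hPK' x hx]]
        have hyδ₁ : 2 * ‖y - x‖ < δ₁ := by
          have := min_le_left δ₁ δ₂; linarith
        have hyδ₂ : 2 * ‖y - x‖ < δ₂ := by
          have := min_le_right δ₁ δ₂; linarith
        -- nearest point
        obtain ⟨b, hb, hnear⟩ := hK.exists_infDist_eq_dist ⟨x, hx⟩ y
        have hbx : ‖b - x‖ ≤ 2 * ‖y - x‖ := norm_nearest_sub_le hx hnear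
        -- the function `G y = PG y m` and its derivative off `K`
        have hder : ∀ s ∈ Ico (0 : ℝ) 1, HasFDerivAt (fun z => PG z m)
            (PG (y + s • (b - y)) (m + 1)).curryLeft (y + s • (b - y)) := by
          intro s hs
          have hz : y + s • (b - y) ∈ Kᶜ := lineMap_nearest_notMem hK hyK hb hnear hs.1 hs.2
          exact (hSG.fderivWithin m hm _ hz).hasFDerivAt (hKo.mem_nhds hz)
        have hbound : ∀ s ∈ Ico (0 : ℝ) 1, ‖(PG (y + s • (b - y)) (m + 1)).curryLeft - L‖ ≤ ε := by
          intro s hs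
          have hz : y + s • (b - y) ∈ Kᶜ := lineMap_nearest_notMem hK hyK hb hnear hs.1 hs.2
          have hzx : dist (y + s • (b - y)) x < δ₁ := by
            rw [dist_eq_norm]
            exact lt_of_le_of_lt (norm_lineMap_sub_le hx hnear hs.1 hs.2.le) hyδ₁
          have h := h₁ hz hzx
          rw [dist_eq_norm] at h
          have key : ∀ A B : E [×(m + 1)]→L[ℝ] F, ‖A.curryLeft - B.curryLeft‖ = ‖A - B‖ := by
            intro A B
            rw [← (A - B).curryLeft_norm]
            congr 1
          rw [hL, key]
          exact h.le
        have hlimb : Tendsto (fun z => PG z m) (𝓝[Kᶜ] b) (𝓝 (PK b m)) := hlim m (hlt hm).le b hb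
        have hstep := norm_sub_sub_le_of_segment hK hyK hb hnear hder hbound hlimb
        -- assemble
        have hPy : P y m = PG y m := by rw [hPG' y hyK]
        have hb₂ : ‖PK b m - PK x m - L (b - x)‖ ≤ ε * ‖b - x‖ :=
          h₂ ⟨show dist b x < δ₂ by rw [dist_eq_norm]; linarith, hb⟩
        have hdecomp : P y m - PK x m - L (y - x) =
            -((PK b m - L b) - (PG y m - L y)) + (PK b m - PK x m - L (b - x)) := by
          rw [hPy, map_sub, map_sub]; abel
        rw [hdecomp]
        calc ‖-((PK b m - L b) - (PG y m - L y)) + (PK b m - PK x m - L (b - x))‖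
            ≤ ‖(PK b m - L b) - (PG y m - L y)‖ + ‖PK b m - PK x m - L (b - x)‖ := by
              rw [← norm_neg ((PK b m - L b) - (PG y m - L y))]; exact norm_add_le _ _
          _ ≤ ε * ‖b - y‖ + ε * ‖b - x‖ := add_le_add hstep hb₂
          _ ≤ ε * ‖y - x‖ + ε * (2 * ‖y - x‖) := by
              refine add_le_add ?_ (mul_le_mul_of_nonneg_left hbx hε0.le)
              refine mul_le_mul_of_nonneg_left ?_ hε0.le
              rw [norm_sub_rev, ← dist_eq_norm, ← hnear, ← dist_eq_norm]
              exact infDist_le_dist_of_mem hx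
          _ = c * ‖y - x‖ := by rw [hε]; ring
    · -- point off `K`
      have h1 : HasFDerivAt (fun y => PG y m) (PG x (m + 1)).curryLeft x :=
        (hSG.fderivWithin m hm x hx).hasFDerivAt (hKo.mem_nhds hx)
      rw [hPG' x hx]
      refine (h1.congr_of_eventuallyEq ?_).hasFDerivWithinAt
      filter_upwards [hKo.mem_nhds hx] with y hy
      rw [hPG' y hy]
  · -- cont
    intro x _
    by_cases hx : x ∈ K
    · have huniv : (univ : Set E) = K ∪ Kᶜ := (union_compl_self K).symm
      rw [ContinuousWithinAt, huniv, nhdsWithin_union, hPK' x hx]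
      refine Tendsto.sup ?_ ?_
      · exact ((hSK.cont m hm x hx).tendsto).congr'
          (eventually_nhdsWithin_of_forall fun y hy => by show PK y m = P y m; rw [hPK' y hy])
      · exact (hlim m (by exact_mod_cast hm) x hx).congr'
          (eventually_nhdsWithin_of_forall fun y hy => by show PG y m = P y m; rw [hPG' y hy])
    · have hc : ContinuousAt (fun y => PG y m) x :=
        (hSG.cont m hm x hx).continuousAt (hKo.mem_nhds hx)
      refine (hc.congr ?_).continuousWithinAt
      filter_upwards [hKo.mem_nhds hx] with y hy
      rw [hPG' y hy]

/-- **`g` is of class `Cᴺ`** under the hypotheses of `hasFTaylorSeriesUpToOn_glued`.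
[cite: Whitney1934, §11] -/
theorem contDiff_of_tendsto_iteratedFDeriv (hK : IsClosed K) (hKu : UniqueDiffOn ℝ K) {N : ℕ}
    (hf : ContDiffOn ℝ N f K) (hg : ContDiffOn ℝ N g Kᶜ) (hfg : EqOn g f K)
    (hlim : ∀ m : ℕ, m ≤ N → ∀ x ∈ K, Tendsto (iteratedFDeriv ℝ m g) (𝓝[Kᶜ] x)
      (𝓝 (iteratedFDerivWithin ℝ m f K x))) :
    ContDiff ℝ N g :=
  contDiffOn_univ.1 (hasFTaylorSeriesUpToOn_glued hK hKu hf hg hfg hlim).contDiffOn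

/-- … **and its derivatives on `K` are the within-derivatives of `f`**. [cite: Whitney1934, §11] -/
theorem iteratedFDeriv_eq_of_tendsto_iteratedFDeriv (hK : IsClosed K) (hKu : UniqueDiffOn ℝ K)
    {N : ℕ} (hf : ContDiffOn ℝ N f K) (hg : ContDiffOn ℝ N g Kᶜ) (hfg : EqOn g f K)
    (hlim : ∀ m : ℕ, m ≤ N → ∀ x ∈ K, Tendsto (iteratedFDeriv ℝ m g) (𝓝[Kᶜ] x)
      (𝓝 (iteratedFDerivWithin ℝ m f K x))) {m : ℕ} (hm : m ≤ N) {x : E} (hx : x ∈ K) :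
    iteratedFDeriv ℝ m g x = iteratedFDerivWithin ℝ m f K x := by
  have h := (hasFTaylorSeriesUpToOn_glued hK hKu hf hg hfg hlim).eq_iteratedFDerivWithin_of_uniqueDiffOn
    (by exact_mod_cast hm) uniqueDiffOn_univ (mem_univ x)
  rw [iteratedFDerivWithin_univ, gluedSeries_of_mem hx] at h
  exact h.symm

/-- All orders: under the hypotheses for every `N`, `g` is `C^∞`. [cite: Whitney1934, §12] -/
theorem contDiff_infty_of_tendsto_iteratedFDeriv (hK : IsClosed K) (hKu : UniqueDiffOn ℝ K)
    (hf : ContDiffOn ℝ ∞ f K) (hg : ContDiffOn ℝ ∞ g Kᶜ) (hfg : EqOn g f K)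
    (hlim : ∀ m : ℕ, ∀ x ∈ K, Tendsto (iteratedFDeriv ℝ m g) (𝓝[Kᶜ] x)
      (𝓝 (iteratedFDerivWithin ℝ m f K x))) :
    ContDiff ℝ ∞ g :=
  contDiff_infty.2 fun N => contDiff_of_tendsto_iteratedFDeriv hK hKu
    (hf.of_le (by exact_mod_cast le_top)) (hg.of_le (by exact_mod_cast le_top)) hfg
    fun m _ x hx => hlim m x hx

end Glue

end Literature.Analysis.Calculus.WhitneyConvex
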